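import Summits.ValiantsHypothesis.ValiantsHypothesis.Theorems.LacunarySymmetroidMatrixDescartesCensusDoorA34SheetTwistedBlocks

/-!
# `MatrixDescartes` census — HEREDITY OF DESCARTES-SHARPNESS UNDER EULER TWISTS (general fewnomial form of the twisted-block anatomy)

HONEST FRAMING.  Object-search cell `pub-symmetroid`, engine seat `val-sym-eng-2` (g8); a format-free tool row filed beside the DoorA34 strata line
(stmt-ValiantsHypothesis-19980) because its three instances there (…DoorA34SheetTwistedBlocks: `twistedSubword_sharp_of_nullTop_eighteen` /
`_of_nullNull_seventeen` / `_of_nineteen`) are what the line uses; the statement itself is about an ARBITRARY real polynomial and is meant for every census format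
(`(2,6)` twenties, the tower rows, the finite registers):

* **`twistedSubword_sharp_of_sharp`** — if a real polynomial `f` is DESCARTES-SHARP (`#supp f ≤ Z₊(f) + 1`, i.e. as many distinct positive roots as a polynomial
  with that many monomials can have) then for EVERY non-empty `B ⊆ supp f` the twisted restriction `f_B` — coefficients `coeff f n · ∏_{u ∈ supp f ∖ B} (n − u)` on `B`,
  zero elsewhere — is Descartes-sharp too: `Z₊(f_B) + 1 = #B`.  (Kill the monomials outside `B` one Euler twist `X·g′ − u·g` at a time; each twist costs at most one
  positive root — `exists_iterTwist`; sparse Descartes bounds `Z₊(f_B) ≤ #B − 1`.)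
* `twistedSubword_card_posRoots_ge` — the quantitative form without the sharpness hypothesis: `Z₊(f) ≤ Z₊(f_B) + #(supp f ∖ B)`.

Consequences are MAGNITUDE-level necessary conditions for Descartes-extremal fewnomials (every sub-word, reweighted by explicit integers, is itself extremal; with
`trinomial_two_posRoots_le` / `newton_cone_coeff` this is the Newton cone and its sub-word refinements).  Nothing here bears on any crux; `DoorA34`, `MatrixDescartes`
and `VP ≠ VNP` untouched — VP≠VNP not moved.  [folklore] Rolle for `x^{−u} g`; Descartes' rule.
-/

-- `Summit.ValiantsHypothesis.ValiantsHypothesis.…` repeats a component by the D-0017 layout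
-- (single-conjunct summit), which the `dupNamespace` linter flags; the name is mandated.
set_option linter.dupNamespace false

namespace Summit.ValiantsHypothesis.ValiantsHypothesis.Theorems.LacunarySymmetroidMatrixDescartes.Census

open Polynomial Finset
open scoped BigOperators Polynomial

/-- **Twisted sub-words: the root budget.**  For any real polynomial `f` and any `B ⊆ supp f` there is a polynomial `g` with
`coeff g n = (∏_{u ∈ supp f ∖ B} (n − u)) · coeff f n` (so `supp g ⊆ B`) and `Z₊(f) ≤ Z₊(g) + #(supp f ∖ B)`. [folklore] -/
theorem twistedSubword_card_posRoots_ge (f : ℝ[X]) (B : Finset ℕ) :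
    ∃ g : ℝ[X],
      (∀ n : ℕ, g.coeff n = (∏ E ∈ (f.support \ B).image (fun m : ℕ => (m : ℝ)), ((n : ℝ) - E)) * f.coeff n) ∧
      g.support ⊆ f.support ∩ B ∧
      (f.roots.toFinset.filter (fun x => 0 < x)).card ≤ (g.roots.toFinset.filter (fun x => 0 < x)).card + (f.support \ B).card := by
  obtain ⟨g, hg, hZ⟩ := exists_iterTwist f ((f.support \ B).image (fun m : ℕ => (m : ℝ)))
  refine ⟨g, hg, ?_, hZ.trans (Nat.add_le_add_left Finset.card_image_le _)⟩
  intro n hn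
  rcases Finset.mem_sdiff.mp (support_subset_sdiff_of_coeff_twists hg hn) with ⟨hnf, hnot⟩
  refine Finset.mem_inter.mpr ⟨hnf, ?_⟩
  by_contra hnB
  exact hnot (Finset.mem_sdiff.mpr ⟨hnf, hnB⟩)

/-- **HEREDITY OF DESCARTES-SHARPNESS UNDER TWISTS.**  If `f` is Descartes-sharp (`#supp f ≤ Z₊(f) + 1`) then for every non-empty `B ⊆ supp f` the twisted
restriction of `f` to `B` has exactly `#B − 1` distinct positive roots. [folklore] -/
theorem twistedSubword_sharp_of_sharp (f : ℝ[X]) (hsharp : f.support.card ≤ (f.roots.toFinset.filter (fun x => 0 < x)).card + 1)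
    (B : Finset ℕ) (hB : B ⊆ f.support) (hB0 : B.Nonempty) :
    ∃ g : ℝ[X],
      (∀ n : ℕ, g.coeff n = (∏ E ∈ (f.support \ B).image (fun m : ℕ => (m : ℝ)), ((n : ℝ) - E)) * f.coeff n) ∧
      g.support ⊆ B ∧
      (g.roots.toFinset.filter (fun x => 0 < x)).card + 1 = B.card := by
  obtain ⟨g, hg, hsupp, hZ⟩ := twistedSubword_card_posRoots_ge f B
  have hsuppB : g.support ⊆ B := hsupp.trans Finset.inter_subset_right
  have hsplit : (f.support \ B).card + B.card = f.support.card := by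
    rw [Finset.card_sdiff_of_subset hB]
    have := Finset.card_le_card hB
    omega
  have hBpos : 1 ≤ B.card := Finset.card_pos.mpr hB0
  refine ⟨g, hg, hsuppB, ?_⟩
  rcases eq_or_ne g 0 with hg0 | hg0
  · rw [hg0, roots_zero, Multiset.toFinset_zero, Finset.filter_empty, Finset.card_empty] at hZ ⊢
    omega
  · have hlt := Literature.Computability.AlgebraicComplexity.card_roots_toFinset_filter_pos_lt_card_support hg0
    have hcard : g.support.card ≤ B.card := Finset.card_le_card hsuppB
    omega

end Summit.ValiantsHypothesis.ValiantsHypothesis.Theorems.LacunarySymmetroidMatrixDescartes.Census
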